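import Mathlib

/-!
# Route `JensenPolynomials`, FAR crux `XiWindowZeroFreeRelFar` (B1-rel) — contour tools IV: the cubic window hypothesis from
a third-derivative bound (RH-FREE; cell rh-jensen, HUMAN RULING D-0040)

The effective Laplace lemmas of `JensenPolynomialsLaplaceWindow{,Linear}.lean` (item `stmt-RiemannHypothesis-19465`)
take the phase in the window shape `‖P u − P u₀ − b(u−u₀) + c(u−u₀)²‖ ≤ M|u−u₀|³` (`|u − u₀| ≤ δ`). Along a horizontal
line through (or near) a saddle the phase is `P(x) = Ψ(x + iy)` for an explicit holomorphic `Ψ`, so `P′, P″, P‴` are the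
complex derivatives of `Ψ` on that line and are explicit. This file turns THREE `HasDerivAt` layers plus a bound
`‖P‴‖ ≤ K` on the window into the window hypothesis with `b = P′(u₀)`, `c = −P″(u₀)/2`, `M = K/6`
(`cubic_window_of_hasDerivAt`; Taylor with the Lagrange-type bound, proved by three applications of Mathlib's fencing
theorem `image_norm_le_of_norm_deriv_right_le_deriv_boundary` and a reflection for the left half-window). No
`iteratedDeriv`/`taylorWithinEval` bookkeeping is exposed to the user.

WHAT THIS IS NOT: first-year calculus; nothing here bears on the zeros of `ζ` or the truth of RH.
-/

noncomputable section
-- D-0017: `Summit.RiemannHypothesis.RiemannHypothesis.…` duplicates the namespace BY DESIGN (single-problem summit).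
set_option linter.dupNamespace false

namespace Summit.RiemannHypothesis.RiemannHypothesis.Theorems.JensenPolynomials.WindowEGF

open Set

/-- One fencing step on `[a, a + δ]`: if `f(a) = 0` and `‖f′(x)‖ ≤ L·(n+1)·(x − a)ⁿ` on the segment, then
`‖f(x)‖ ≤ L·(x − a)ⁿ⁺¹` there (Mathlib's `image_norm_le_of_norm_deriv_right_le_deriv_boundary` with the polynomial fence). -/
theorem norm_le_mul_pow_succ_of_hasDerivAt {E : Type*} [NormedAddCommGroup E] [NormedSpace ℝ E]
    {f f' : ℝ → E} {a δ L : ℝ} (n : ℕ)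
    (hf : ∀ x ∈ Icc a (a + δ), HasDerivAt f (f' x) x) (ha : f a = 0)
    (bound : ∀ x ∈ Icc a (a + δ), ‖f' x‖ ≤ L * (n + 1) * (x - a) ^ n) :
    ∀ x ∈ Icc a (a + δ), ‖f x‖ ≤ L * (x - a) ^ (n + 1) := by
  have hcont : ContinuousOn f (Icc a (a + δ)) := fun x hx => (hf x hx).continuousAt.continuousWithinAt
  have hB : ∀ x, HasDerivAt (fun x => L * (x - a) ^ (n + 1)) (L * (n + 1) * (x - a) ^ n) x := by
    intro x
    have h1 : HasDerivAt (fun x => (x - a) ^ (n + 1)) (((n + 1 : ℕ) : ℝ) * (x - a) ^ n * 1) x :=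
      ((hasDerivAt_id x).sub_const a).pow (n + 1)
    have h2 := h1.const_mul L
    exact h2.congr_deriv (by push_cast; ring)
  intro x hx
  exact image_norm_le_of_norm_deriv_right_le_deriv_boundary hcont
    (fun y hy => (hf y (Ico_subset_Icc_self hy)).hasDerivWithinAt) (by simp [ha]) hB
    (fun y hy => bound y (Ico_subset_Icc_self hy)) hx

/-- **Right half-window.** Three `HasDerivAt` layers `P → P₁ → P₂ → P₃` on `[u₀, u₀ + δ]` and `‖P₃‖ ≤ K` there give
`‖P u − P u₀ − P₁(u₀)(u−u₀) − (P₂(u₀)/2)(u−u₀)²‖ ≤ (K/6)(u−u₀)³` for `u ∈ [u₀, u₀ + δ]`. -/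
theorem norm_taylor_three_right {P P₁ P₂ P₃ : ℝ → ℂ} {u₀ δ K : ℝ}
    (h1 : ∀ u ∈ Icc u₀ (u₀ + δ), HasDerivAt P (P₁ u) u)
    (h2 : ∀ u ∈ Icc u₀ (u₀ + δ), HasDerivAt P₁ (P₂ u) u)
    (h3 : ∀ u ∈ Icc u₀ (u₀ + δ), HasDerivAt P₂ (P₃ u) u)
    (hK : ∀ u ∈ Icc u₀ (u₀ + δ), ‖P₃ u‖ ≤ K) :
    ∀ u ∈ Icc u₀ (u₀ + δ),
      ‖P u - P u₀ - P₁ u₀ * (u - u₀) - P₂ u₀ / 2 * (u - u₀) ^ 2‖ ≤ K / 6 * (u - u₀) ^ 3 := by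
  -- the affine map `u ↦ (u : ℂ) − u₀` and its square
  have hl : ∀ u : ℝ, HasDerivAt (fun u : ℝ => ((u : ℂ) - u₀)) 1 u := fun u => by
    simpa using ((hasDerivAt_id (u : ℝ)).ofReal_comp).sub_const (u₀ : ℂ)
  have hq : ∀ u : ℝ, HasDerivAt (fun u : ℝ => ((u : ℂ) - u₀) ^ 2) (2 * ((u : ℂ) - u₀)) u := fun u => by
    have h := (hl u).mul (hl u)
    exact (h.congr_deriv (by ring)).congr_of_eventuallyEq (Filter.Eventually.of_forall fun y => by
      show ((y : ℂ) - u₀) ^ 2 = ((y : ℂ) - u₀) * ((y : ℂ) - u₀)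
      ring)
  -- layer 2: R₂ u = P₂ u − P₂ u₀, ‖R₂ u‖ ≤ K (u − u₀)
  have hA : ∀ u ∈ Icc u₀ (u₀ + δ), ‖P₂ u - P₂ u₀‖ ≤ K * (u - u₀) ^ (0 + 1) :=
    norm_le_mul_pow_succ_of_hasDerivAt (f := fun u => P₂ u - P₂ u₀) (f' := P₃) 0
      (fun u hu => (h3 u hu).sub_const _) (by simp) (fun u hu => by simpa using hK u hu)
  -- layer 1: R₁ u = P₁ u − P₁ u₀ − P₂ u₀ (u − u₀), ‖R₁ u‖ ≤ (K/2) (u − u₀)²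
  have hB : ∀ u ∈ Icc u₀ (u₀ + δ), ‖P₁ u - P₁ u₀ - P₂ u₀ * ((u : ℂ) - u₀)‖ ≤ K / 2 * (u - u₀) ^ (1 + 1) := by
    refine norm_le_mul_pow_succ_of_hasDerivAt (f := fun u => P₁ u - P₁ u₀ - P₂ u₀ * ((u : ℂ) - u₀))
      (f' := fun u => P₂ u - P₂ u₀) 1 (fun u hu => ?_) (by simp) (fun u hu => ?_)
    · have h := ((h2 u hu).sub_const (P₁ u₀)).sub ((hl u).const_mul (P₂ u₀))
      exact (h.congr_deriv (by ring)).congr_of_eventuallyEq (Filter.Eventually.of_forall fun y => rfl)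
    · have := hA u hu
      calc ‖P₂ u - P₂ u₀‖ ≤ K * (u - u₀) ^ (0 + 1) := this
        _ = K / 2 * ((1 : ℕ) + 1) * (u - u₀) ^ 1 := by push_cast; ring
  -- layer 0
  have hC : ∀ u ∈ Icc u₀ (u₀ + δ),
      ‖P u - P u₀ - P₁ u₀ * (u - u₀) - P₂ u₀ / 2 * (u - u₀) ^ 2‖ ≤ K / 6 * (u - u₀) ^ (2 + 1) := by
    refine norm_le_mul_pow_succ_of_hasDerivAt
      (f := fun u => P u - P u₀ - P₁ u₀ * ((u : ℂ) - u₀) - P₂ u₀ / 2 * ((u : ℂ) - u₀) ^ 2)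
      (f' := fun u => P₁ u - P₁ u₀ - P₂ u₀ * ((u : ℂ) - u₀)) 2 (fun u hu => ?_) (by simp) (fun u hu => ?_)
    · have h := (((h1 u hu).sub_const (P u₀)).sub ((hl u).const_mul (P₁ u₀))).sub ((hq u).const_mul (P₂ u₀ / 2))
      exact (h.congr_deriv (by ring)).congr_of_eventuallyEq (Filter.Eventually.of_forall fun y => rfl)
    · have := hB u hu
      calc ‖P₁ u - P₁ u₀ - P₂ u₀ * ((u : ℂ) - u₀)‖ ≤ K / 2 * (u - u₀) ^ (1 + 1) := this
        _ = K / 6 * ((2 : ℕ) + 1) * (u - u₀) ^ 2 := by push_cast; ring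
  intro u hu
  simpa using hC u hu

/-- **Cubic window hypothesis from three derivative layers («Taylor» brick).** If `P → P₁ → P₂ → P₃` are `HasDerivAt`
layers on the window `|u − u₀| ≤ δ` and `‖P₃ u‖ ≤ K` there, then for `|u − u₀| ≤ δ`
`‖P u − P u₀ − P₁(u₀)·(u−u₀) + (−(P₂(u₀)/2))·(u−u₀)²‖ ≤ (K/6)·|u−u₀|³` — the window shape of
`JensenPolynomialsLaplaceWindowLinear.lean` with `b = P₁ u₀`, `c = −P₂ u₀/2`, `M = K/6`. -/
theorem cubic_window_of_hasDerivAt {P P₁ P₂ P₃ : ℝ → ℂ} {u₀ δ K : ℝ}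
    (h1 : ∀ u, |u - u₀| ≤ δ → HasDerivAt P (P₁ u) u)
    (h2 : ∀ u, |u - u₀| ≤ δ → HasDerivAt P₁ (P₂ u) u)
    (h3 : ∀ u, |u - u₀| ≤ δ → HasDerivAt P₂ (P₃ u) u)
    (hK : ∀ u, |u - u₀| ≤ δ → ‖P₃ u‖ ≤ K) :
    ∀ u, |u - u₀| ≤ δ →
      ‖P u - P u₀ - P₁ u₀ * (u - u₀) + (-(P₂ u₀ / 2)) * (u - u₀) ^ 2‖ ≤ K / 6 * |u - u₀| ^ 3 := by
  intro u hu
  have hδ : 0 ≤ δ := (abs_nonneg _).trans hu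
  have hmemR : ∀ v ∈ Icc u₀ (u₀ + δ), |v - u₀| ≤ δ := fun v hv =>
    abs_sub_le_iff.2 ⟨by linarith [hv.2], by linarith [hv.1]⟩
  rcases le_total u₀ u with hle | hle
  · -- right half-window
    have huI : u ∈ Icc u₀ (u₀ + δ) := ⟨hle, by linarith [(abs_le.mp hu).2]⟩
    have h := norm_taylor_three_right (fun v hv => h1 v (hmemR v hv)) (fun v hv => h2 v (hmemR v hv))
      (fun v hv => h3 v (hmemR v hv)) (fun v hv => hK v (hmemR v hv)) u huI
    rw [abs_of_nonneg (by linarith : 0 ≤ u - u₀)]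
    have e : P u - P u₀ - P₁ u₀ * (u - u₀) + (-(P₂ u₀ / 2)) * (u - u₀) ^ 2 =
        P u - P u₀ - P₁ u₀ * (u - u₀) - P₂ u₀ / 2 * (u - u₀) ^ 2 := by ring
    rw [e]; exact h
  · -- left half-window: reflect `v ↦ 2u₀ − v`
    have hmemL : ∀ v ∈ Icc u₀ (u₀ + δ), |2 * u₀ - v - u₀| ≤ δ := fun v hv => by
      rw [show 2 * u₀ - v - u₀ = -(v - u₀) by ring, abs_neg]; exact hmemR v hv
    have hrefl : ∀ v : ℝ, HasDerivAt (fun v : ℝ => 2 * u₀ - v) (-1) v := fun v => by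
      simpa using (hasDerivAt_id v).const_sub (2 * u₀)
    have g1 : ∀ v ∈ Icc u₀ (u₀ + δ), HasDerivAt (fun v => P (2 * u₀ - v)) ((fun v => -P₁ (2 * u₀ - v)) v) v := by
      intro v hv
      have h0 := (h1 _ (hmemL v hv)).scomp v (hrefl v)
      exact (h0.congr_deriv (by simp)).congr_of_eventuallyEq (Filter.Eventually.of_forall fun y => rfl)
    have g2 : ∀ v ∈ Icc u₀ (u₀ + δ),
        HasDerivAt (fun v => -P₁ (2 * u₀ - v)) ((fun v => P₂ (2 * u₀ - v)) v) v := by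
      intro v hv
      have h0 := ((h2 _ (hmemL v hv)).scomp v (hrefl v)).neg
      exact (h0.congr_deriv (by simp)).congr_of_eventuallyEq (Filter.Eventually.of_forall fun y => rfl)
    have g3 : ∀ v ∈ Icc u₀ (u₀ + δ),
        HasDerivAt (fun v => P₂ (2 * u₀ - v)) ((fun v => -P₃ (2 * u₀ - v)) v) v := by
      intro v hv
      have h0 := (h3 _ (hmemL v hv)).scomp v (hrefl v)
      exact (h0.congr_deriv (by simp)).congr_of_eventuallyEq (Filter.Eventually.of_forall fun y => rfl)
    have gK : ∀ v ∈ Icc u₀ (u₀ + δ), ‖(fun v => -P₃ (2 * u₀ - v)) v‖ ≤ K := fun v hv => by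
      simpa using hK _ (hmemL v hv)
    set v : ℝ := 2 * u₀ - u with hv
    have hvI : v ∈ Icc u₀ (u₀ + δ) := ⟨by rw [hv]; linarith, by rw [hv]; linarith [(abs_le.mp hu).1]⟩
    have h := norm_taylor_three_right g1 g2 g3 gK v hvI
    have e1 : 2 * u₀ - v = u := by rw [hv]; ring
    have e2 : 2 * u₀ - u₀ = u₀ := by ring
    simp only [e1, e2] at h
    rw [abs_of_nonpos (by linarith : u - u₀ ≤ 0)]
    have e3 : P u - P u₀ - P₁ u₀ * (u - u₀) + (-(P₂ u₀ / 2)) * (u - u₀) ^ 2 =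
        P u - P u₀ - -P₁ u₀ * ((v : ℂ) - u₀) - P₂ u₀ / 2 * ((v : ℂ) - u₀) ^ 2 := by
      rw [hv]; push_cast; ring
    have e4 : K / 6 * (-(u - u₀)) ^ 3 = K / 6 * (v - u₀) ^ 3 := by rw [hv]; ring
    rw [e3, e4]
    exact h

end Summit.RiemannHypothesis.RiemannHypothesis.Theorems.JensenPolynomials.WindowEGF

end
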